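import Literature.Analysis.FluidPDE.MollifiedNSRTripleLocal
import Literature.Analysis.FluidPDE.BVEnergyStageTools
import HarnessLib

/-!
# The energy stage of Buckmaster–Vicol (Ann. of Math. 189 (2019), §7), I: preparation of the
  base triple (mollification, time cut-off of the energy gap, gluing, the pump weight and the
  rescaled stress)

Analysis/FluidPDE support file (everything proved). Given a classical NSR triple `(v, p, R)` on
`[0,T] × (UnitAddTorus (Fin 3))` with `C¹` size `V`, stress of sup size `A` and `L¹` size `δ_R`, an energy profile
`e` with gap `G = e - ∫|v|² ∈ [0, Δ]` and `R = 0` wherever `G ≤ Δ/100` (hypotheses (2.2)–(2.6) of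
BV 2019, Prop. 2.1 at level `q`, `Δ = δ_{q+1}`), and the next amplitude `δ = δ_{q+2} ≤ Δ/100`,
`EnergyPump.base_prep` produces:

* the mollified triple `(v_ℓ, p_ℓ, R_c + M̊)` of `exists_mollified_nsr_package_local`, the mollified
  gap `G_ℓ = e - ∫|v_ℓ|²`, the time cut-off `θ = cut(δ/8, δ/8) ∘ G_ℓ` and the glued triple
  `(v_b, p_b, R_b)` of `(v, p, R)` (where `θ = 0`, small gap) and the mollified triple (where
  `θ = 1`) (`Torus.IsNSReynoldsOn.glue`);
* the pump weight `s = ψ_δ(G_ℓ)/√(2Δ) ∈ [0,1]` (`s = 0` iff `G_ℓ ≤ 3δ/8`, and then `s' = 0`;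
  `s ≠ 0 ⇒ θ = 1`), the rescaled stress `N = (floorFun √c₀ ∘ s)⁻² M` with `s² N̊ = M̊`
  (`c₀ = 1/800`: `M(t) ≠ 0` forces `G_ℓ(t) ≥ Δ/200` by the locality of the mollification and the
  hypothesis (2.6), hence `s(t)² ≥ c₀`), so that `R_b = R_cb + s² N̊` with `R_cb` small;
* all the bounds needed downstream (sizes of `v_b`, `R_cb`, `N` and its `ℓ⁻¹`-losses, `|s'|`,
  `|θ'|, |θ''|`, the comparison of the gaps, the quiet zone `{G_ℓ < 3δ/8}` where `R ≡ M ≡ 0`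
  nearby and the `C¹` bounds of `R_cb` there, and the untouched zone `{G_ℓ ≤ δ/8}` where
  `v_b = v`, `R_cb = 0`).

## References

* T. Buckmaster, V. Vicol, Ann. of Math. 189 (2019) = arXiv:1709.10033, Prop. 2.1, §4.1, §7. [`BuckmasterVicol2019Annals`]
-/

noncomputable section

open MeasureTheory Set Filter Topology Function
open scoped InnerProductSpace ContDiff ENNReal NNReal

namespace Literature.Analysis.FluidPDE

namespace EnergyPump

open Literature.Analysis.FunctionSpaces FunctionSpaces.Torus Literature.Analysis.Calculus


/-- **Mean value within `[0,T]`**: `|G s - G t| ≤ Λ |s - t|`. [folklore] -/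
theorem abs_sub_le_of_derivWithin {T : ℝ} {G : ℝ → ℝ} (hG : ContDiffOn ℝ ∞ G (Icc 0 T)) {Λ : ℝ}
    (hΛ : ∀ t ∈ Icc 0 T, |derivWithin G (Icc 0 T) t| ≤ Λ) {s t : ℝ} (hs : s ∈ Icc 0 T) (ht : t ∈ Icc 0 T) :
    |G s - G t| ≤ Λ * |s - t| := by
  have h := Convex.norm_image_sub_le_of_norm_derivWithin_le (hG.differentiableOn (by simp)) (fun x hx => by rw [Real.norm_eq_abs]; exact hΛ x hx)
    (convex_Icc 0 T) ht hs
  rwa [Real.norm_eq_abs, Real.norm_eq_abs] at h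

/-- `traceless (c • S) = c • traceless S`. [folklore] -/
theorem traceless_const_smul (c : ℝ) (S : (UnitAddTorus (Fin 3)) → Fin 3 → (EuclideanSpace ℝ (Fin 3))) : Torus.traceless (c • S) = c • Torus.traceless S := by
  rw [Torus.traceless_eq_comp, Torus.traceless_eq_comp]
  funext x; simp [map_smul]

set_option maxHeartbeats 6000000 in
/-- **Preparation of the base triple for the energy stage** (see the module docstring).
[cite: BuckmasterVicol2019Annals, Prop. 2.1, §4.1, §7] -/
theorem base_prep : ∃ C : ℝ, 1 ≤ C ∧ ∃ K : ℝ, 0 ≤ K ∧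
    ∀ (T ν : ℝ) (e : ℝ → ℝ) (E₁ E₂ : ℝ) (v : ℝ → (UnitAddTorus (Fin 3)) → (EuclideanSpace ℝ (Fin 3))) (p : ℝ → (UnitAddTorus (Fin 3)) → ℝ) (R : ℝ → (UnitAddTorus (Fin 3)) → Fin 3 → (EuclideanSpace ℝ (Fin 3))) (V A δR Δ δ ℓ : ℝ),
    0 < T → ContDiffOn ℝ ∞ e (Icc 0 T) →
    (∀ t ∈ Icc 0 T, |derivWithin e (Icc 0 T) t| ≤ E₁) → (∀ t ∈ Icc 0 T, |derivWithin (derivWithin e (Icc 0 T)) (Icc 0 T) t| ≤ E₂) →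
    Torus.IsNSReynoldsOn (Icc 0 T) ν v p R → (∀ t ∈ Icc 0 T, HasZeroMean (v t)) →
    1 ≤ V → (∀ t ∈ Icc 0 T, ∀ x, ‖v t x‖ ≤ V) → (∀ i, ∀ t ∈ Icc 0 T, ∀ x, ‖Torus.partialDeriv i (v t) x‖ ≤ V) →
    (∀ t ∈ Icc 0 T, ∀ x, ‖Torus.timeDerivWithin (Icc 0 T) v t x‖ ≤ V) →
    1 ≤ A → (∀ t ∈ Icc 0 T, ∀ x, ‖R t x‖ ≤ A) → 0 < δR → (∀ t ∈ Icc 0 T, ∫ x, ‖R t x‖ ≤ δR) →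
    0 < δ → δ ≤ Δ / 100 →
    (∀ t ∈ Icc 0 T, 0 ≤ e t - ∫ x, ‖v t x‖ ^ 2 ∧ e t - ∫ x, ‖v t x‖ ^ 2 ≤ Δ) →
    (∀ t ∈ Icc 0 T, e t - ∫ x, ‖v t x‖ ^ 2 ≤ Δ / 100 → ∀ x, R t x = 0) →
    0 < ℓ → ℓ ≤ 1 / 4 → 8 * ℓ ≤ T →
    -- the one smallness condition of the preparation: `η + 7ℓΛ₀ ≤ Δ/200`
    (2 * (C * V) + C * (V + V) * ℓ) * (C * (V + V) * ℓ) + 7 * ℓ * (E₁ + 2 * V * V) ≤ Δ / 200 →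
    ∃ (vb : ℝ → (UnitAddTorus (Fin 3)) → (EuclideanSpace ℝ (Fin 3))) (pb : ℝ → (UnitAddTorus (Fin 3)) → ℝ) (Rcb N : ℝ → (UnitAddTorus (Fin 3)) → Fin 3 → (EuclideanSpace ℝ (Fin 3))) (s θ Gm : ℝ → ℝ)
      (D₀ η Λ₁ Λ₂ Θ₁ Θ₂ S' ρc Vb Sb₁ Sb₂ : ℝ),
      -- the derived sizes
      D₀ = C * (V + V) * ℓ ∧ η = (2 * (C * V) + D₀) * D₀ ∧
      Λ₁ = E₁ + 2 * (C * V) * (C * (V + V)) ∧ Λ₂ = E₂ + 2 * (C * (V + V) * (C * (V + V)) + C * V * (C * V * ℓ⁻¹ ^ 2)) ∧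
      Θ₁ = D₁ / (δ / 8) * Λ₁ ∧ Θ₂ = D₂ / (δ / 8) ^ 2 * Λ₁ ^ 2 + D₁ / (δ / 8) * Λ₂ ∧
      S' = (2 * (D₁ + 1) / Real.sqrt δ + 8 * D₁ * Real.sqrt ((Δ + η) + δ) / δ) * Λ₁ / Real.sqrt (2 * Δ) ∧
      ρc = C * (V + 1 / T) * (V + V) * ℓ + D₀ ^ 2 / 2 + K * (Θ₁ * D₀) ∧
      Vb = C * (V + V) + Θ₁ * D₀ ∧
      Sb₁ = (C * V * (V * ℓ⁻¹ + (V + V)) + K * (C * (1 / T) * V * ℓ⁻¹)) + D₀ * (C * (V + V) + V) + K * (Θ₁ * (C * (V + V) + V)) ∧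
      Sb₂ = Θ₁ * (C * (V + 1 / T) * (V + V) * ℓ) + (C * V * (V * ℓ⁻¹ + (V + V)) + K * (C * (1 / T) * V * ℓ⁻¹)) +
        2 * Θ₁ * D₀ ^ 2 + D₀ * (C * (V + V) + V) + K * (Θ₂ * D₀ + Θ₁ * (C * (V + V) + V)) ∧
      -- the triple `(v_b, p_b, R_cb + s² N̊)`
      Torus.IsNSReynoldsOn (Icc 0 T) ν vb pb (fun t y j => Rcb t y j + (s t) ^ 2 • Torus.traceless (N t) y j) ∧
      (∀ t ∈ Icc 0 T, HasZeroMean (vb t)) ∧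
      FunctionSpaces.Torus.IsSmoothSpaceTimeOn (Icc 0 T) Rcb ∧ (∀ t ∈ Icc 0 T, ∀ y, ∀ i j : Fin 3, Rcb t y i j = Rcb t y j i) ∧
      (∀ t ∈ Icc 0 T, ∀ y, ∑ i, Rcb t y i i = 0) ∧
      FunctionSpaces.Torus.IsSmoothSpaceTimeOn (Icc 0 T) N ∧ (∀ t ∈ Icc 0 T, ∀ y, ∀ i j : Fin 3, N t y i j = N t y j i) ∧
      -- the weight
      ContDiffOn ℝ ∞ s (Icc 0 T) ∧ (∀ t ∈ Icc 0 T, 0 ≤ s t ∧ s t ≤ 1) ∧ (∀ t ∈ Icc 0 T, |derivWithin s (Icc 0 T) t| ≤ S') ∧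
      (∀ t ∈ Icc 0 T, s t = 0 → derivWithin s (Icc 0 T) t = 0) ∧
      (∀ t, s t = 0 ↔ Gm t ≤ 3 * δ / 8) ∧
      -- the cut-off
      ContDiffOn ℝ ∞ θ (Icc 0 T) ∧ (∀ t, 0 ≤ θ t ∧ θ t ≤ 1) ∧
      (∀ t ∈ Icc 0 T, |derivWithin θ (Icc 0 T) t| ≤ Θ₁) ∧ (∀ t ∈ Icc 0 T, |derivWithin (derivWithin θ (Icc 0 T)) (Icc 0 T) t| ≤ Θ₂) ∧
      (∀ t, θ t ≠ 1 → Gm t < δ / 4) ∧ (∀ t, θ t ≠ 0 → δ / 8 < Gm t) ∧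
      (∀ t ∈ Icc 0 T, (θ t = 0 ∨ θ t = 1) → derivWithin θ (Icc 0 T) t = 0 ∧ derivWithin (derivWithin θ (Icc 0 T)) (Icc 0 T) t = 0) ∧
      -- sizes of the base velocity, the carried stress, the rescaled stress
      (∀ t ∈ Icc 0 T, ∀ y, ‖vb t y‖ ≤ Vb) ∧ (∀ i, ∀ t ∈ Icc 0 T, ∀ y, ‖Torus.partialDeriv i (vb t) y‖ ≤ Vb) ∧
      (∀ t ∈ Icc 0 T, ∀ y, ‖Torus.timeDerivWithin (Icc 0 T) vb t y‖ ≤ Vb) ∧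
      (∀ t ∈ Icc 0 T, ∀ y, ‖Rcb t y‖ ≤ ρc) ∧
      (∀ t ∈ Icc 0 T, ∀ y, ‖N t y‖ ≤ 3200 * (C * A)) ∧
      (∀ t ∈ Icc 0 T, ∀ y l, ‖Torus.partialDeriv l (N t) y‖ ≤ 3200 * (C * A * ℓ⁻¹)) ∧
      (∀ t ∈ Icc 0 T, ∀ y, ‖Torus.timeDerivWithin (Icc 0 T) N t y‖ ≤ (2 * (D₁ + 1) * (2 / Real.sqrt (1 / 800)) ^ 3 * S') * (C * A) + 3200 * (C * A * ℓ⁻¹)) ∧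
      (∀ t ∈ Icc 0 T, ∀ y l m, ‖Torus.partialDeriv m (Torus.partialDeriv l (N t)) y‖ ≤ 3200 * (C * A * ℓ⁻¹ ^ 2)) ∧
      (∀ t ∈ Icc 0 T, ∀ y l, ‖Torus.timeDerivWithin (Icc 0 T) (fun s' z => Torus.partialDeriv l (N s') z) t y‖ ≤
        (2 * (D₁ + 1) * (2 / Real.sqrt (1 / 800)) ^ 3 * S') * (C * A * ℓ⁻¹) + 3200 * (C * A * ℓ⁻¹ ^ 2)) ∧
      (∀ t ∈ Icc 0 T, ∫ y, ‖N t y‖ ≤ 3200 * (C * δR)) ∧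
      -- the gaps: `G = e - ∫|v|²`, `G_ℓ = Gm`, `G_b = e - ∫|v_b|²`
      ContDiffOn ℝ ∞ Gm (Icc 0 T) ∧
      (∀ t ∈ Icc 0 T, |(e t - ∫ y, ‖v t y‖ ^ 2) - Gm t| ≤ η) ∧ (∀ t ∈ Icc 0 T, |(e t - ∫ y, ‖vb t y‖ ^ 2) - Gm t| ≤ η) ∧
      (∀ t ∈ Icc 0 T, ∀ y, ‖vb t y - v t y‖ ≤ D₀) ∧
      -- the pump: where `s ≠ 0`, `θ = 1` and `s² · 2Δ = ψ_δ(G_ℓ)²`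
      (∀ t, (s t) ^ 2 * (2 * Δ) = pumpProfile δ (Gm t) ^ 2) ∧ (∀ t, s t ≠ 0 → θ t = 1) ∧
      -- the untouched zone `G_ℓ ≤ δ/8`
      (∀ t ∈ Icc 0 T, Gm t ≤ δ / 8 → vb t = v t ∧ Rcb t = 0) ∧
      -- the quiet zone `G_ℓ < 3δ/8`: `C¹` bounds of `R_cb`
      (∀ t ∈ Icc 0 T, Gm t < 3 * δ / 8 → ∀ y l, ‖Torus.partialDeriv l (Rcb t) y‖ ≤ Sb₁ ∧ ‖Torus.timeDerivWithin (Icc 0 T) Rcb t y‖ ≤ Sb₂) := by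
  obtain ⟨C, hC1, hpkg⟩ := Torus.exists_mollified_nsr_package_local (d := Fin 3) (by simp)
  obtain ⟨K, hK0, hK⟩ := Torus.exists_norm_antidivergence_le (d := Fin 3) (by simp)
  refine ⟨C, hC1, K, hK0, ?_⟩
  intro T ν e E₁ E₂ v p R V A δR Δ δ ℓ hT he hE₁ hE₂ hns hmean hV1 hv0 hv1 hvt hA1 hRA hδR hRδ hδ hδΔ hgap hR0 hℓ hℓ4 hℓT hsmall
  have hC0 : 0 ≤ C := by linarith
  have hV0 : 0 ≤ V := by linarith
  have hU : UniqueDiffOn ℝ (Icc (0:ℝ) T) := uniqueDiffOn_Icc hT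
  have hΔ : 0 < Δ := by linarith
  have h0T : (0:ℝ) ∈ Icc 0 T := ⟨le_rfl, hT.le⟩
  -- ### Step 1: mollification
  obtain ⟨vm, pm, Rc, Rcm, M, Rdef, hold, hvmmean, hRcS, hMS, hMsym, hRcsym, hvm0, hvmv, hvm1, hvmt, hRcb, hMδ, hMA, hM1, hM2,
    hMt, hMt1, -, hRcdef, hRcmS, hRdefS, -, hRcm0, hRdef0, hRcm1, hRcmt, hRdef1, hRdeft, hvmtt, hMloc⟩ :=
    hpkg T ν v p R hns hT hmean V V V A δR ℓ hv0 hv1 hvt hV0 hV0 hRA hRδ hℓ hℓ4 hℓT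
  have hvS : FunctionSpaces.Torus.IsSmoothSpaceTimeOn (Icc 0 T) v := hns.smooth_velocity
  have hvmS : FunctionSpaces.Torus.IsSmoothSpaceTimeOn (Icc 0 T) vm := hold.smooth_velocity
  -- the derived sizes
  set D₀ : ℝ := C * (V + V) * ℓ with hD₀
  set η : ℝ := (2 * (C * V) + D₀) * D₀ with hη
  set Λ₀ : ℝ := E₁ + 2 * V * V with hΛ₀
  set Λ₁ : ℝ := E₁ + 2 * (C * V) * (C * (V + V)) with hΛ₁
  set Λ₂ : ℝ := E₂ + 2 * (C * (V + V) * (C * (V + V)) + C * V * (C * V * ℓ⁻¹ ^ 2)) with hΛ₂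
  set Θ₁ : ℝ := D₁ / (δ / 8) * Λ₁ with hΘ₁
  set Θ₂ : ℝ := D₂ / (δ / 8) ^ 2 * Λ₁ ^ 2 + D₁ / (δ / 8) * Λ₂ with hΘ₂
  have hD00 : 0 ≤ D₀ := by positivity
  have hη0 : 0 ≤ η := by positivity
  have hηsmall : η + 7 * ℓ * Λ₀ ≤ Δ / 200 := hsmall
  have hΛ00 : 0 ≤ Λ₀ := by have := hE₁ 0 h0T; have := abs_nonneg (derivWithin e (Icc 0 T) 0); nlinarith
  have hηΔ : η ≤ Δ / 200 := by nlinarith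
  -- ### Step 2: the gaps
  set G : ℝ → ℝ := fun t => e t - ∫ y, ‖v t y‖ ^ 2 with hGdef
  set Gm : ℝ → ℝ := fun t => e t - ∫ y, ‖vm t y‖ ^ 2 with hGmdef
  have hEv := contDiffOn_energy hT hvS
  have hEvm := contDiffOn_energy hT hvmS
  have hGs : ContDiffOn ℝ ∞ G (Icc 0 T) := he.sub hEv
  have hGms : ContDiffOn ℝ ∞ Gm (Icc 0 T) := he.sub hEvm
  -- `|G - Gm| ≤ η`
  have hGGm : ∀ t ∈ Icc 0 T, |G t - Gm t| ≤ η := by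
    intro t ht
    have h1 := abs_integral_norm_sq_sub_le (u := vm t) (v := v t) (hvmS.isSmooth_slice ht).continuous (hvS.isSmooth_slice ht).continuous
      (B := C * V) (D := D₀) (fun y => (hv0 t ht y).trans (by nlinarith)) (fun y => hvmv t ht y)
    have e1 : G t - Gm t = (∫ y, ‖vm t y‖ ^ 2) - ∫ y, ‖v t y‖ ^ 2 := by simp only [hGdef, hGmdef]; ring
    rw [e1]; exact h1
  -- derivative bounds of `G`, `Gm`
  have hG' : ∀ t ∈ Icc 0 T, |derivWithin G (Icc 0 T) t| ≤ Λ₀ := by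
    intro t ht
    have hd : derivWithin G (Icc 0 T) t = derivWithin e (Icc 0 T) t - derivWithin (fun s => ∫ y, ‖v s y‖ ^ 2) (Icc 0 T) t :=
      derivWithin_sub ((he.differentiableOn (by simp)) t ht) ((hEv.differentiableOn (by simp)) t ht)
    rw [hd]
    have h1 := hE₁ t ht
    have h2 := abs_derivWithin_energy_le hT hvS hv0 hvt ht
    exact (abs_sub _ _).trans (by linarith)
  have hGm' : ∀ t ∈ Icc 0 T, |derivWithin Gm (Icc 0 T) t| ≤ Λ₁ := by
    intro t ht
    have hd : derivWithin Gm (Icc 0 T) t = derivWithin e (Icc 0 T) t - derivWithin (fun s => ∫ y, ‖vm s y‖ ^ 2) (Icc 0 T) t :=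
      derivWithin_sub ((he.differentiableOn (by simp)) t ht) ((hEvm.differentiableOn (by simp)) t ht)
    rw [hd]
    have h1 := hE₁ t ht
    have h2 := abs_derivWithin_energy_le hT hvmS (B₀ := C * V) (Bt := C * (V + V)) (fun t ht y => hvm0 t y) hvmt ht
    exact (abs_sub _ _).trans (by linarith)
  have hGm'' : ∀ t ∈ Icc 0 T, |derivWithin (derivWithin Gm (Icc 0 T)) (Icc 0 T) t| ≤ Λ₂ := by
    intro t ht
    have hde := contDiffOn_derivWithin hT he
    have hdE := contDiffOn_derivWithin hT hEvm
    have heq : EqOn (derivWithin Gm (Icc 0 T)) (fun s => derivWithin e (Icc 0 T) s - derivWithin (fun s => ∫ y, ‖vm s y‖ ^ 2) (Icc 0 T) s) (Icc 0 T) :=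
      fun s hs => derivWithin_sub ((he.differentiableOn (by simp)) s hs) ((hEvm.differentiableOn (by simp)) s hs)
    have k1 := ((hde.differentiableOn (by simp)) t ht).hasDerivWithinAt
    have k2 := ((hdE.differentiableOn (by simp)) t ht).hasDerivWithinAt
    have k : HasDerivWithinAt (fun s => derivWithin e (Icc 0 T) s - derivWithin (fun s => ∫ y, ‖vm s y‖ ^ 2) (Icc 0 T) s)
        (derivWithin (derivWithin e (Icc 0 T)) (Icc 0 T) t - derivWithin (derivWithin (fun s => ∫ y, ‖vm s y‖ ^ 2) (Icc 0 T)) (Icc 0 T) t)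
        (Icc 0 T) t := k1.sub k2
    rw [derivWithin_congr heq (heq ht), k.derivWithin (hU t ht)]
    have h1 := hE₂ t ht
    have h2 := abs_derivWithin_derivWithin_energy_le hT hvmS (B₀ := C * V) (Bt := C * (V + V)) (Btt := C * V * ℓ⁻¹ ^ 2)
      (fun t ht y => hvm0 t y) hvmt hvmtt ht
    exact (abs_sub _ _).trans (by linarith)
  -- the range of `Gm`
  have hGm_range : ∀ t ∈ Icc 0 T, -η ≤ Gm t ∧ Gm t ≤ Δ + η := by
    intro t ht
    have h1 := abs_le.1 (hGGm t ht); have h2 := hgap t ht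
    simp only [hGdef] at h1
    constructor <;> linarith [h1.1, h1.2, h2.1, h2.2]
  have hGm_abs : ∀ t ∈ Icc 0 T, |Gm t| ≤ Δ + η := fun t ht => abs_le.2 ⟨by linarith [(hGm_range t ht).1, hΔ], (hGm_range t ht).2⟩
  -- ### Step 3: the key zone lemma: `Gm t < Δ/200 ⇒ R ≡ 0 ≡ M` near `t`
  have hzone : ∀ t ∈ Icc 0 T, Gm t < Δ / 200 → (∀ x, M t x = 0) ∧ (∀ x, R t x = 0) := by
    intro t ht hlt
    have hRs : ∀ s ∈ Icc 0 T, |s - t| ≤ 7 * ℓ → ∀ y, R s y = 0 := by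
      intro s hs hst
      refine hR0 s hs ?_
      have h1 := abs_sub_le_of_derivWithin hGs hG' hs ht
      have h2 := abs_le.1 (hGGm t ht)
      have h3 : Λ₀ * |s - t| ≤ 7 * ℓ * Λ₀ := by nlinarith
      show G s ≤ Δ / 100
      have := (abs_le.1 h1).2
      linarith
    exact ⟨hMloc t ht hRs, hRs t ht (by simp; positivity)⟩
  have hδ200 : 3 * δ / 8 < Δ / 200 := by linarith
  -- ### Step 4: the cut-off `θ`
  set θ : ℝ → ℝ := gapCut (δ / 8) (δ / 8) Gm with hθdef
  have hh8 : 0 < δ / 8 := by positivity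
  have hθs : ContDiffOn ℝ ∞ θ (Icc 0 T) := contDiffOn_gapCut hGms
  have hθ01 : ∀ t, 0 ≤ θ t ∧ θ t ≤ 1 := fun t => gapCut_mem _ _ _ t
  have hθ' : ∀ t ∈ Icc 0 T, |derivWithin θ (Icc 0 T) t| ≤ Θ₁ := fun t ht => abs_derivWithin_gapCut_le hT hh8 hGms hGm' ht
  have hθ'' : ∀ t ∈ Icc 0 T, |derivWithin (derivWithin θ (Icc 0 T)) (Icc 0 T) t| ≤ Θ₂ := fun t ht =>
    abs_derivWithin_derivWithin_gapCut_le hT hh8 hGms hGm' hGm'' ht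
  have hθne1 : ∀ t, θ t ≠ 1 → Gm t < δ / 4 := fun t h1 => by have := lt_of_gapCut_ne_one (G := Gm) hh8 h1; linarith
  have hθne0 : ∀ t, θ t ≠ 0 → δ / 8 < Gm t := fun t h0 => lt_of_gapCut_ne_zero (G := Gm) hh8 h0
  have hθflat : ∀ t ∈ Icc 0 T, (θ t = 0 ∨ θ t = 1) → derivWithin θ (Icc 0 T) t = 0 ∧ derivWithin (derivWithin θ (Icc 0 T)) (Icc 0 T) t = 0 :=
    fun t ht h01 => gapCut_flat hT hh8 hGms ht h01
  have hΘ₁0 : 0 ≤ Θ₁ := (abs_nonneg _).trans (hθ' 0 h0T)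
  have hΘ₂0 : 0 ≤ Θ₂ := (abs_nonneg _).trans (hθ'' 0 h0T)
  -- where `θ ≠ 1`, everything vanishes: `Gm < δ/4 < Δ/200`
  have hzone1 : ∀ t ∈ Icc 0 T, θ t ≠ 1 → (∀ x, M t x = 0) ∧ (∀ x, R t x = 0) := fun t ht h1 =>
    hzone t ht (by have := hθne1 t h1; linarith)
  -- ### Step 5: gluing
  have hglue := hns.glue hold hT hθs (by simp) hmean hvmmean
  set vb := Torus.glueVel θ v vm with hvbdef
  set pb := Torus.gluePres θ v vm p pm with hpbdef
  set Rb := Torus.glueStress T θ v vm R (fun t x j => Rc t x j + Torus.traceless (M t) x j) with hRbdef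
  have hdiff : ∀ t ∈ Icc 0 T, ∀ y, ‖Torus.glueDiff v vm t y‖ ≤ D₀ := fun t ht y => hvmv t ht y
  have hdiff1 : ∀ t ∈ Icc 0 T, ∀ y l, ‖Torus.partialDeriv l (Torus.glueDiff v vm t) y‖ ≤ C * (V + V) + V := by
    intro t ht y l
    have e1 : Torus.partialDeriv l (Torus.glueDiff v vm t) y = Torus.partialDeriv l (vm t) y - Torus.partialDeriv l (v t) y :=
      Torus.partialDeriv_sub_at ((hvmS.isSmooth_slice ht).isContDiff (by simp)) ((hvS.isSmooth_slice ht).isContDiff (by simp)) l y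
    rw [e1]; exact (norm_sub_le _ _).trans (add_le_add (hvm1 t ht y l) (hv1 l t ht y))
  have hdifft : ∀ t ∈ Icc 0 T, ∀ y, ‖Torus.timeDerivWithin (Icc 0 T) (Torus.glueDiff v vm) t y‖ ≤ C * (V + V) + V := by
    intro t ht y
    have e1 : Torus.timeDerivWithin (Icc 0 T) (Torus.glueDiff v vm) t y = Torus.timeDerivWithin (Icc 0 T) vm t y - Torus.timeDerivWithin (Icc 0 T) v t y := by
      show derivWithin (fun s => vm s y - v s y) (Icc 0 T) t = _
      exact derivWithin_sub (hvmS.hasDerivWithinAt_slice ht y).differentiableWithinAt (hvS.hasDerivWithinAt_slice ht y).differentiableWithinAt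
    rw [e1]; exact (norm_sub_le _ _).trans (add_le_add (hvmt t ht y) (hvt t ht y))
  -- ### Step 6: the weight `s` and the rescaled stress `N`
  set s : ℝ → ℝ := fun t => pumpProfile δ (Gm t) / Real.sqrt (2 * Δ) with hsdef
  have h2Δ : 0 < Real.sqrt (2 * Δ) := Real.sqrt_pos.2 (by linarith)
  have hsq2Δ : Real.sqrt (2 * Δ) ^ 2 = 2 * Δ := Real.sq_sqrt (by linarith)
  have hss : ContDiffOn ℝ ∞ s (Icc 0 T) := contDiffOn_comp (g := fun y => pumpProfile δ y / Real.sqrt (2 * Δ)) ((contDiff_pumpProfile hδ).div_const _) hGms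
  have hs_sq : ∀ t, (s t) ^ 2 * (2 * Δ) = pumpProfile δ (Gm t) ^ 2 := by
    intro t; simp only [hsdef]; rw [div_pow, hsq2Δ]; field_simp
  have hs0 : ∀ t, 0 ≤ s t := fun t => div_nonneg (pumpProfile_nonneg _ _) h2Δ.le
  have hs_zero : ∀ t, s t = 0 ↔ Gm t ≤ 3 * δ / 8 := by
    intro t; simp only [hsdef, div_eq_zero_iff, h2Δ.ne', or_false]; exact pumpProfile_eq_zero_iff hδ
  have hs01 : ∀ t ∈ Icc 0 T, 0 ≤ s t ∧ s t ≤ 1 := by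
    intro t ht
    refine ⟨hs0 t, ?_⟩
    have h1 : (s t) ^ 2 ≤ 1 := by
      have h2 := pumpProfile_sq_le hδ (Gm t)
      have h3 : max (Gm t - δ / 4) 0 ≤ 2 * Δ := max_le (by linarith [(hGm_range t ht).2]) (by linarith)
      have := hs_sq t
      nlinarith
    nlinarith [hs0 t]
  set Ψ₁ : ℝ := 2 * (D₁ + 1) / Real.sqrt δ + 8 * D₁ * Real.sqrt ((Δ + η) + δ) / δ with hΨ₁
  set S' : ℝ := Ψ₁ * Λ₁ / Real.sqrt (2 * Δ) with hS'def
  have hΛ₁0 : 0 ≤ Λ₁ := (abs_nonneg _).trans (hGm' 0 h0T)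
  have hs' : ∀ t ∈ Icc 0 T, |derivWithin s (Icc 0 T) t| ≤ S' := by
    intro t ht
    have hd := derivWithin_comp hT (g := fun y => pumpProfile δ y / Real.sqrt (2 * Δ)) ((contDiff_pumpProfile hδ).div_const _) hGms ht
    have e1 : deriv (fun y => pumpProfile δ y / Real.sqrt (2 * Δ)) (Gm t) = deriv (pumpProfile δ) (Gm t) / Real.sqrt (2 * Δ) := by
      rw [deriv_div_const]
    rw [show s = fun t => (fun y => pumpProfile δ y / Real.sqrt (2 * Δ)) (Gm t) from rfl, hd, e1, abs_mul, abs_div, abs_of_pos h2Δ]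
    have h1 := abs_deriv_pumpProfile_le hδ (Gm t)
    have h2 : Real.sqrt (|Gm t| + δ) ≤ Real.sqrt ((Δ + η) + δ) := Real.sqrt_le_sqrt (by linarith [hGm_abs t ht])
    have h3 : |deriv (pumpProfile δ) (Gm t)| ≤ Ψ₁ := by
      refine h1.trans ?_
      simp only [hΨ₁]
      have hD1 := D₁_nonneg
      gcongr
    calc |deriv (pumpProfile δ) (Gm t)| / Real.sqrt (2 * Δ) * |derivWithin Gm (Icc 0 T) t| ≤ Ψ₁ / Real.sqrt (2 * Δ) * Λ₁ :=
          mul_le_mul (div_le_div_of_nonneg_right h3 h2Δ.le) (hGm' t ht) (abs_nonneg _) (div_nonneg ((abs_nonneg _).trans h3) h2Δ.le)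
      _ = S' := by simp only [hS'def]; ring
  have hS'0 : 0 ≤ S' := (abs_nonneg _).trans (hs' 0 h0T)
  have hs_flat : ∀ t ∈ Icc 0 T, s t = 0 → derivWithin s (Icc 0 T) t = 0 := by
    intro t ht h0
    have hd := derivWithin_comp hT (g := fun y => pumpProfile δ y / Real.sqrt (2 * Δ)) ((contDiff_pumpProfile hδ).div_const _) hGms ht
    rw [show s = fun t => (fun y => pumpProfile δ y / Real.sqrt (2 * Δ)) (Gm t) from rfl, hd, deriv_div_const,
      deriv_pumpProfile_of_le hδ ((hs_zero t).1 h0)]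
    simp
  -- `s ≠ 0 ⇒ θ = 1`
  have hsθ : ∀ t, s t ≠ 0 → θ t = 1 := by
    intro t h
    have : ¬ Gm t ≤ 3 * δ / 8 := fun h' => h ((hs_zero t).2 h')
    exact gapCut_of_ge hh8 (by linarith [lt_of_not_ge this])
  -- `M t ≠ 0 ⇒ s t ≥ √c₀`
  set c₀ : ℝ := 1 / 800 with hc₀
  have hc₀pos : (0:ℝ) < 1 / 800 := by norm_num
  have hsc₀ : ∀ t ∈ Icc 0 T, (∃ x, M t x ≠ 0) → c₀ ≤ (s t) ^ 2 := by
    intro t ht ⟨x, hx⟩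
    have hge : Δ / 200 ≤ Gm t := by
      by_contra hlt; exact hx ((hzone t ht (lt_of_not_ge hlt)).1 x)
    have h1 : pumpProfile δ (Gm t) ^ 2 = Gm t - δ / 4 := pumpProfile_sq_of_ge hδ (by linarith)
    have h2 := hs_sq t
    rw [h1] at h2
    -- `s² = (Gm - δ/4)/(2Δ) ≥ (Δ/200 - Δ/400)/(2Δ) = 1/800`
    have : (s t) ^ 2 * (2 * Δ) ≥ Δ / 400 := by linarith
    by_contra hlt
    have : (s t) ^ 2 * (2 * Δ) < c₀ * (2 * Δ) := mul_lt_mul_of_pos_right (lt_of_not_ge hlt) (by linarith)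
    simp only [hc₀] at this
    linarith
  -- the floor weight `g = (floorFun √c₀ ∘ s)⁻²`
  have hsc : (0:ℝ) < Real.sqrt (1 / 800) := Real.sqrt_pos.2 hc₀pos
  set g : ℝ → ℝ := fun t => (floorFun (Real.sqrt (1 / 800)) (s t))⁻¹ ^ 2 with hgdef
  have hG₂ : ContDiff ℝ ∞ (fun z => (floorFun (Real.sqrt (1 / 800)) z)⁻¹ ^ 2) :=
    ((contDiff_floorFun _).inv fun z => (floorFun_pos hsc z).ne').pow 2
  have hgs : ContDiffOn ℝ ∞ g (Icc 0 T) := contDiffOn_comp (g := fun z => (floorFun (Real.sqrt (1 / 800)) z)⁻¹ ^ 2) hG₂ hss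
  have hg_le : ∀ t ∈ Icc 0 T, |g t| ≤ 3200 := by
    intro t _
    have hb := floorWeight_bounds hsc (s t)
    simp only [hgdef]
    rw [abs_of_pos hb.1]
    refine hb.2.1.trans (le_of_eq ?_)
    rw [div_pow, Real.sq_sqrt hc₀pos.le]; norm_num
  have hg'_le : ∀ t ∈ Icc 0 T, |derivWithin g (Icc 0 T) t| ≤ 2 * (D₁ + 1) * (2 / Real.sqrt (1 / 800)) ^ 3 * S' := by
    intro t ht
    have := abs_derivWithin_comp_le hT (g := fun z => (floorFun (Real.sqrt (1 / 800)) z)⁻¹ ^ 2) hG₂ hss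
      (fun y => (floorWeight_bounds hsc y).2.2) hs' ht
    exact this
  -- `s² g = 1` where `M ≠ 0`
  have hsg : ∀ t ∈ Icc 0 T, (∃ x, M t x ≠ 0) → (s t) ^ 2 * g t = 1 := by
    intro t ht hM
    have h1 := hsc₀ t ht hM
    have hs1 : Real.sqrt (1 / 800) ≤ s t := by
      rw [← Real.sqrt_sq (hs0 t)]; exact Real.sqrt_le_sqrt h1
    have hspos : 0 < s t := lt_of_lt_of_le hsc hs1
    simp only [hgdef, floorFun_of_ge hsc hs1]
    field_simp
  set N : ℝ → (UnitAddTorus (Fin 3)) → Fin 3 → (EuclideanSpace ℝ (Fin 3)) := tscale g M with hNdef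
  have hNS : FunctionSpaces.Torus.IsSmoothSpaceTimeOn (Icc 0 T) N := isSmoothSpaceTimeOn_tscale hgs hMS
  have hNsym : ∀ t ∈ Icc 0 T, ∀ y, ∀ i j : Fin 3, N t y i j = N t y j i := fun t _ y i j => tscale_symm (hMsym t y) i j
  -- **(H₁)**: `s² N̊ = M̊`
  have hH1 : ∀ t ∈ Icc 0 T, ∀ y j, (s t) ^ 2 • Torus.traceless (N t) y j = Torus.traceless (M t) y j := by
    intro t ht y j
    have eN : Torus.traceless (N t) = g t • Torus.traceless (M t) := by
      show Torus.traceless (g t • M t) = _; exact traceless_const_smul _ _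
    rw [eN, Pi.smul_apply, Pi.smul_apply, smul_smul]
    by_cases hM : ∃ x, M t x ≠ 0
    · rw [hsg t ht hM, one_smul]
    · simp only [not_exists, not_not] at hM
      have hM0 : M t = 0 := funext fun x => hM x
      have : Torus.traceless (M t) = 0 := by
        rw [hM0]; funext x j'; simp [Torus.traceless_apply, Torus.tensorTrace]
      rw [this]; simp
  -- ### Step 7: `R_cb`
  set Rcb : ℝ → (UnitAddTorus (Fin 3)) → Fin 3 → (EuclideanSpace ℝ (Fin 3)) := fun t y j => Rb t y j - (s t) ^ 2 • Torus.traceless (N t) y j with hRcbdef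
  have hRbS : FunctionSpaces.Torus.IsSmoothSpaceTimeOn (Icc 0 T) Rb := hglue.smooth_stress
  have hs2N : FunctionSpaces.Torus.IsSmoothSpaceTimeOn (Icc 0 T) (fun t y j => (s t) ^ 2 • Torus.traceless (N t) y j) := by
    have h1 : FunctionSpaces.Torus.IsSmoothSpaceTimeOn (Icc 0 T) (fun t (_ : (UnitAddTorus (Fin 3))) => (s t) ^ 2) := Torus.isSmoothSpaceTimeOn_time (hss.pow 2)
    exact h1.smul hNS.traceless
  have hRcbS : FunctionSpaces.Torus.IsSmoothSpaceTimeOn (Icc 0 T) Rcb := hRbS.sub hs2N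
  have hstress : Rb = fun t y j => Rcb t y j + (s t) ^ 2 • Torus.traceless (N t) y j := by
    funext t y j; simp only [hRcbdef, sub_add_cancel]
  have hRcb_eq : ∀ t ∈ Icc 0 T, ∀ y j, Rcb t y j = Rb t y j - Torus.traceless (M t) y j := by
    intro t ht y j; simp only [hRcbdef, hH1 t ht y j]
  have hNSR : Torus.IsNSReynoldsOn (Icc 0 T) ν vb pb (fun t y j => Rcb t y j + (s t) ^ 2 • Torus.traceless (N t) y j) := hstress ▸ hglue
  -- zero mean of `v_b`
  have hvbmean : ∀ t ∈ Icc 0 T, HasZeroMean (vb t) := by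
    intro t ht
    show ∫ y, vb t y = 0
    have e1 : vb t = fun y => (1 - θ t) • v t y + θ t • vm t y := rfl
    have i1 : Integrable (fun y => (1 - θ t) • v t y) volume := ((hvS.isSmooth_slice ht).continuous.const_smul (1 - θ t)).integrable_unitAddTorus
    have i2 : Integrable (fun y => θ t • vm t y) volume := ((hvmS.isSmooth_slice ht).continuous.const_smul (θ t)).integrable_unitAddTorus
    rw [e1, integral_add i1 i2, integral_smul, integral_smul, show ∫ y, v t y = 0 from hmean t ht, show ∫ y, vm t y = 0 from hvmmean t ht]
    simp
  -- symmetry and trace of `R_cb`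
  have hRcbsym : ∀ t ∈ Icc 0 T, ∀ y, ∀ i j : Fin 3, Rcb t y i j = Rcb t y j i := by
    intro t ht y i j
    simp only [hRcbdef, PiLp.sub_apply, PiLp.smul_apply]
    rw [hglue.symm t ht y i j, Torus.traceless_symm (hNsym t ht y) i j]
  have hRcbtr : ∀ t ∈ Icc 0 T, ∀ y, ∑ i, Rcb t y i i = 0 := by
    intro t ht y
    simp only [hRcbdef, PiLp.sub_apply, PiLp.smul_apply, Finset.sum_sub_distrib, smul_eq_mul, ← Finset.mul_sum]
    rw [hglue.traceFree t ht y, Torus.sum_traceless_apply_apply]; simp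
  -- ### Step 8: bounds
  -- `v_b`
  set Vb : ℝ := C * (V + V) + Θ₁ * D₀ with hVb
  have hVCV : V ≤ C * V := by nlinarith
  have hV2 : C * V ≤ C * (V + V) := by nlinarith
  have hvb0 : ∀ t ∈ Icc 0 T, ∀ y, ‖vb t y‖ ≤ Vb := fun t ht y =>
    (Torus.norm_glueVel_le (hθ01 t).1 (hθ01 t).2 ((hv0 t ht y).trans hVCV) (hvm0 t y)).trans (by simp only [hVb]; nlinarith)
  have hvb1 : ∀ i, ∀ t ∈ Icc 0 T, ∀ y, ‖Torus.partialDeriv i (vb t) y‖ ≤ Vb := fun i t ht y =>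
    (Torus.norm_partialDeriv_glueVel_le hns hold ht (hθ01 t).1 (hθ01 t).2 i ((hv1 i t ht y).trans (hVCV.trans hV2)) (hvm1 t ht y i)).trans
      (by simp only [hVb]; nlinarith)
  have hvbt : ∀ t ∈ Icc 0 T, ∀ y, ‖Torus.timeDerivWithin (Icc 0 T) vb t y‖ ≤ Vb := by
    intro t ht y
    have h1 := Torus.norm_timeDerivWithin_glueVel_le hns hold hT hθs ht (hθ01 t).1 (hθ01 t).2 ((hvt t ht y).trans (hVCV.trans hV2)) (hvmt t ht y)
    refine h1.trans ?_
    simp only [hVb]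
    have := mul_le_mul (hθ' t ht) (hdiff t ht y) (norm_nonneg _) hΘ₁0
    exact add_le_add le_rfl this
  have hvbv : ∀ t ∈ Icc 0 T, ∀ y, ‖vb t y - v t y‖ ≤ D₀ := fun t ht y =>
    (Torus.norm_glueVel_sub_le (hθ01 t).1 (hθ01 t).2 y).trans (hdiff t ht y)
  -- `R_cb`: the two zones
  set ρ₁ : ℝ := C * (V + 1 / T) * (V + V) * ℓ with hρ₁
  set ρc : ℝ := ρ₁ + D₀ ^ 2 / 2 + K * (Θ₁ * D₀) with hρc
  have hρ₁0 : 0 ≤ ρ₁ := by positivity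
  have hMtr0 : ∀ t, (∀ x, M t x = 0) → Torus.traceless (M t) = 0 := by
    intro t hM
    have hM0 : M t = 0 := funext fun x => hM x
    rw [hM0]; funext x j'; simp [Torus.traceless_apply, Torus.tensorTrace]
  have hRcb0 : ∀ t ∈ Icc 0 T, ∀ y, ‖Rcb t y‖ ≤ ρc := by
    intro t ht y
    have eRcb : Rcb t y = Rb t y - Torus.traceless (M t) y := by funext j; exact hRcb_eq t ht y j
    by_cases h1 : θ t = 1
    · -- active zone: `R_b = R_c + M̊`, `R_cb = R_c`
      have hθ'0 := (hθflat t ht (Or.inr h1)).1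
      have e1 : Rb t = fun y j => Rc t y j + Torus.traceless (M t) y j := Torus.glueStress_of_eq_one h1 hθ'0
      have : Rcb t y = Rc t y := by rw [eRcb, e1]; funext j; simp
      rw [this]
      exact (hRcb t ht y).trans (by simp only [hρc]; nlinarith [mul_nonneg hK0 (mul_nonneg hΘ₁0 hD00)])
    · -- quiet: `R = 0 = M`
      obtain ⟨hM0, hR0'⟩ := hzone1 t ht h1
      have hR0f : R t = 0 := funext fun x => hR0' x
      have h2 := Torus.norm_glueStress_le hns hold hK ht (hθ01 t).1 (hθ01 t).2 hD00 (hdiff t ht) y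
        (R₀ := R) (R₁ := fun t x j => Rc t x j + Torus.traceless (M t) x j)
      rw [eRcb, hMtr0 t hM0]
      simp only [Pi.zero_apply, sub_zero]
      refine h2.trans ?_
      rw [hR0f]
      have e2 : (fun j => Rc t y j + Torus.traceless (M t) y j) = Rc t y := by funext j; rw [hMtr0 t hM0]; simp
      simp only [Pi.zero_apply, norm_zero, zero_add]
      rw [e2]
      have := hRcb t ht y
      have := mul_le_mul_of_nonneg_left (mul_le_mul_of_nonneg_right (hθ' t ht) hD00) hK0
      simp only [hρc]
      show ‖Rc t y‖ + D₀ ^ 2 / 2 + K * (|derivWithin θ (Icc 0 T) t| * D₀) ≤ ρ₁ + D₀ ^ 2 / 2 + K * (Θ₁ * D₀)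
      linarith
  -- `N`
  have hNb := fun t (ht : t ∈ Icc 0 T) y l m => tscale_bounds hT hgs hMS hg_le hg'_le ht y l m (M := M)
  have hN0 : ∀ t ∈ Icc 0 T, ∀ y, ‖N t y‖ ≤ 3200 * (C * A) := fun t ht y =>
    ((hNb t ht y 0 0).1).trans (mul_le_mul_of_nonneg_left (hMA t y) (by norm_num))
  have hN1 : ∀ t ∈ Icc 0 T, ∀ y l, ‖Torus.partialDeriv l (N t) y‖ ≤ 3200 * (C * A * ℓ⁻¹) := fun t ht y l =>
    ((hNb t ht y l 0).2.1).trans (mul_le_mul_of_nonneg_left (hM1 t y l) (by norm_num))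
  have hN2 : ∀ t ∈ Icc 0 T, ∀ y l m, ‖Torus.partialDeriv m (Torus.partialDeriv l (N t)) y‖ ≤ 3200 * (C * A * ℓ⁻¹ ^ 2) := fun t ht y l m =>
    ((hNb t ht y m l).2.2.1).trans (mul_le_mul_of_nonneg_left (hM2 t y m l) (by norm_num))
  set Γ₁ : ℝ := 2 * (D₁ + 1) * (2 / Real.sqrt (1 / 800)) ^ 3 * S' with hΓ₁
  have hΓ₁0 : 0 ≤ Γ₁ := by have := D₁_nonneg; positivity
  have hNt : ∀ t ∈ Icc 0 T, ∀ y, ‖Torus.timeDerivWithin (Icc 0 T) N t y‖ ≤ Γ₁ * (C * A) + 3200 * (C * A * ℓ⁻¹) := fun t ht y =>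
    ((hNb t ht y 0 0).2.2.2.1).trans (add_le_add (mul_le_mul_of_nonneg_left (hMA t y) hΓ₁0) (mul_le_mul_of_nonneg_left (hMt t ht y) (by norm_num)))
  have hNt1 : ∀ t ∈ Icc 0 T, ∀ y l, ‖Torus.timeDerivWithin (Icc 0 T) (fun s' z => Torus.partialDeriv l (N s') z) t y‖ ≤
      Γ₁ * (C * A * ℓ⁻¹) + 3200 * (C * A * ℓ⁻¹ ^ 2) := fun t ht y l =>
    ((hNb t ht y l 0).2.2.2.2).trans (add_le_add (mul_le_mul_of_nonneg_left (hM1 t y l) hΓ₁0) (mul_le_mul_of_nonneg_left (hMt1 t ht y l) (by norm_num)))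
  have hNL1 : ∀ t ∈ Icc 0 T, ∫ y, ‖N t y‖ ≤ 3200 * (C * δR) := by
    intro t ht
    have hc : Continuous fun y => ‖N t y‖ := (hNS.isSmooth_slice ht).continuous.norm
    calc ∫ y, ‖N t y‖ ≤ ∫ y, 3200 * ‖M t y‖ := integral_mono hc.integrable_unitAddTorus
          (((hMS.isSmooth_slice ht).continuous.norm.const_mul _).integrable_unitAddTorus) fun y => (hNb t ht y 0 0).1
      _ ≤ 3200 * (C * δR) := by rw [integral_const_mul]; exact mul_le_mul_of_nonneg_left (hMδ t) (by norm_num)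
  -- the gap of `v_b`
  have hGbGm : ∀ t ∈ Icc 0 T, |(e t - ∫ y, ‖vb t y‖ ^ 2) - Gm t| ≤ η := by
    intro t ht
    have hvbvm : ∀ y, ‖vb t y - vm t y‖ ≤ D₀ := by
      intro y
      have e1 : vb t y - vm t y = (1 - θ t) • (v t y - vm t y) := by
        show (1 - θ t) • v t y + θ t • vm t y - vm t y = _
        rw [smul_sub]; module
      rw [e1, norm_smul, Real.norm_eq_abs, abs_of_nonneg (by linarith [(hθ01 t).2]), norm_sub_rev]
      exact (mul_le_of_le_one_left (norm_nonneg _) (by linarith [(hθ01 t).1])).trans (hvmv t ht y)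
    have h1 := abs_integral_norm_sq_sub_le (u := vb t) (v := vm t) (hglue.smooth_velocity.isSmooth_slice ht).continuous
      (hvmS.isSmooth_slice ht).continuous (B := C * V) (D := D₀) (fun y => hvm0 t y) hvbvm
    have e1 : (e t - ∫ y, ‖vb t y‖ ^ 2) - Gm t = -((∫ y, ‖vb t y‖ ^ 2) - ∫ y, ‖vm t y‖ ^ 2) := by simp only [hGmdef]; ring
    rw [e1, abs_neg]; exact h1
  have hGGm' : ∀ t ∈ Icc 0 T, |(e t - ∫ y, ‖v t y‖ ^ 2) - Gm t| ≤ η := hGGm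
  -- ### Step 9: the untouched zone
  have huntouched : ∀ t ∈ Icc 0 T, Gm t ≤ δ / 8 → vb t = v t ∧ Rcb t = 0 := by
    intro t ht hle
    have hθ0 : θ t = 0 := gapCut_of_le hh8 hle
    have hθ'0 := (hθflat t ht (Or.inl hθ0)).1
    obtain ⟨hM0, hR0'⟩ := hzone t ht (by linarith)
    refine ⟨Torus.glueVel_of_eq_zero hθ0, ?_⟩
    have e1 : Rb t = R t := Torus.glueStress_of_eq_zero hθ0 hθ'0
    funext y j
    rw [hRcb_eq t ht y j, e1, hR0' y, hMtr0 t hM0]; simp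
  -- ### Step 10: the quiet zone `Gm < 3δ/8`: `R ≡ 0 ≡ M` near `t`, and the `C¹` bounds of `R_cb`
  set D₁' : ℝ := C * (V + V) + V with hD₁'
  have hD₁'0 : 0 ≤ D₁' := by positivity
  set Sc : ℝ := C * V * (V * ℓ⁻¹ + (V + V)) + K * (C * (1 / T) * V * ℓ⁻¹) with hSc
  set Sb₁ : ℝ := Sc + D₀ * D₁' + K * (Θ₁ * D₁') with hSb₁
  set Sb₂ : ℝ := Θ₁ * ρ₁ + Sc + 2 * Θ₁ * D₀ ^ 2 + D₀ * D₁' + K * (Θ₂ * D₀ + Θ₁ * D₁') with hSb₂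
  -- `C¹` bounds of `R_c = R_cm + ℛ R_def`
  have hRc1 : ∀ t ∈ Icc 0 T, ∀ y l, ‖Torus.partialDeriv l (Rc t) y‖ ≤ Sc := by
    intro t ht y l
    have hRcmt : IsSmooth (Rcm t) := hRcmS.isSmooth_slice ht
    have hRdeft : IsSmooth (Rdef t) := hRdefS.isSmooth_slice ht
    have e1 : Rc t = fun y j => Rcm t y j + Torus.antidivergence (Rdef t) y j := by funext y j; exact hRcdef t y j
    have e2 : Torus.partialDeriv l (Rc t) y = Torus.partialDeriv l (Rcm t) y + Torus.partialDeriv l (Torus.antidivergence (Rdef t)) y := by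
      rw [e1]
      exact ((hRcmt.hasDerivAt_line_zero l y).add ((Torus.isSmooth_antidivergence hRdeft).hasDerivAt_line_zero l y)).deriv
    rw [e2]
    refine (norm_add_le _ _).trans (add_le_add (hRcm1 t ht y l) ?_)
    exact Torus.norm_partialDeriv_antidivergence_le hK hRdeft l (by positivity) (fun x => hRdef1 t ht x l) y
  have hRct : ∀ t ∈ Icc 0 T, ∀ y, ‖Torus.timeDerivWithin (Icc 0 T) Rc t y‖ ≤ Sc := by
    intro t ht y
    have e1 : Rc = fun t y j => Rcm t y j + Torus.antidivergence (Rdef t) y j := by funext t y j; exact hRcdef t y j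
    have e2 : Torus.timeDerivWithin (Icc 0 T) Rc t y = Torus.timeDerivWithin (Icc 0 T) Rcm t y +
        Torus.timeDerivWithin (Icc 0 T) (fun s => Torus.antidivergence (Rdef s)) t y := by
      rw [e1]
      show derivWithin (fun s => (fun j => Rcm s y j + Torus.antidivergence (Rdef s) y j)) (Icc 0 T) t = _
      have k1 := hRcmS.hasDerivWithinAt_slice ht y
      have k2 := (hRdefS.antidivergence (convex_Icc 0 T) (by rw [interior_Icc]; exact nonempty_Ioo.2 hT)).hasDerivWithinAt_slice ht y
      have := (k1.add k2).derivWithin (hU t ht)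
      exact this
    rw [e2]
    refine (norm_add_le _ _).trans (add_le_add (hRcmt t ht y) ?_)
    exact Torus.norm_timeDerivWithin_antidivergence_le hK hT hRdefS ht (by positivity) (fun x => hRdeft t ht x) y
  have hquiet : ∀ t ∈ Icc 0 T, Gm t < 3 * δ / 8 → ∀ y l, ‖Torus.partialDeriv l (Rcb t) y‖ ≤ Sb₁ ∧ ‖Torus.timeDerivWithin (Icc 0 T) Rcb t y‖ ≤ Sb₂ := by
    intro t ht hlt y l
    -- a neighbourhood where `Gm < Δ/200`
    have hcont : ContinuousWithinAt Gm (Icc 0 T) t := (hGms.continuousOn t ht)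
    obtain ⟨r, hr, hball⟩ : ∃ r > 0, ∀ s' ∈ Icc 0 T, |s' - t| < r → Gm s' < Δ / 200 := by
      have hev : ∀ᶠ s' in 𝓝[Icc 0 T] t, Gm s' < Δ / 200 := hcont.eventually (gt_mem_nhds (by linarith))
      obtain ⟨u, hu, hsub⟩ := Metric.mem_nhdsWithin_iff.1 hev
      exact ⟨u, hu, fun s' hs' hd => hsub ⟨by rwa [Metric.mem_ball, Real.dist_eq], hs'⟩⟩
    have hRnear : ∀ s' ∈ Icc 0 T, |s' - t| < r → R s' = 0 := fun s' hs' hd => funext fun x => (hzone s' hs' (hball s' hs' hd)).2 x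
    have hMnear : ∀ s' ∈ Icc 0 T, |s' - t| < r → Torus.traceless (M s') = 0 := fun s' hs' hd => hMtr0 s' (hzone s' hs' (hball s' hs' hd)).1
    obtain ⟨hM0, hR0'⟩ := hzone t ht (by linarith)
    have hR0f : R t = 0 := funext fun x => hR0' x
    have hM0f := hMtr0 t hM0
    -- `R_cb t = R_b t` as functions of `y` (at time `t`) and nearby
    have eRcbRb : ∀ s' ∈ Icc 0 T, |s' - t| < r → Rcb s' = Rb s' := by
      intro s' hs' hd
      funext y' j
      rw [hRcb_eq s' hs' y' j, hMnear s' hs' hd]; simp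
    have hsmooth1 : FunctionSpaces.Torus.IsSmoothSpaceTimeOn (Icc 0 T) (fun t x j => Rc t x j + Torus.traceless (M t) x j) := hold.smooth_stress
    constructor
    · -- space derivative
      rw [eRcbRb t ht (by simpa using hr)]
      have h1 := Torus.norm_partialDeriv_glueStress_le hns hold hK ht (hθ01 t).1 (hθ01 t).2 l hD00 hD₁'0 (hdiff t ht) (fun z => hdiff1 t ht z l) y
        (R₀ := R) (R₁ := fun t x j => Rc t x j + Torus.traceless (M t) x j)
      simp only [show Torus.glueRate T θ = derivWithin θ (Icc 0 T) from rfl] at h1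
      refine h1.trans ?_
      have e0 : Torus.partialDeriv l (R t) y = 0 := by rw [hR0f]; exact Torus.partialDeriv_const_apply _ l y
      have e1 : Torus.partialDeriv l ((fun t x j => Rc t x j + Torus.traceless (M t) x j) t) y = Torus.partialDeriv l (Rc t) y := by
        congr 1; funext x j; show Rc t x j + Torus.traceless (M t) x j = Rc t x j; rw [hM0f]; simp
      rw [e0, e1, norm_zero, zero_add]
      have := hRc1 t ht y l
      have := mul_le_mul_of_nonneg_left (mul_le_mul_of_nonneg_right (hθ' t ht) hD₁'0) hK0
      simp only [hSb₁]
      linarith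
    · -- time derivative
      have e0 : Torus.timeDerivWithin (Icc 0 T) Rcb t y = Torus.timeDerivWithin (Icc 0 T) Rb t y :=
        timeDerivWithin_congr_of_ball hr ht eRcbRb y
      rw [e0]
      have h1 := Torus.norm_timeDerivWithin_glueStress_le hns hold hT hθs hK ht (hθ01 t).1 (hθ01 t).2 hD00 hD₁'0 (hdiff t ht) (hdifft t ht) y
        (R₀ := R) (R₁ := fun t x j => Rc t x j + Torus.traceless (M t) x j)
      simp only [show Torus.glueRate T θ = derivWithin θ (Icc 0 T) from rfl] at h1
      refine h1.trans ?_
      have eR0 : Torus.timeDerivWithin (Icc 0 T) R t y = 0 := timeDerivWithin_eq_zero_of_ball hr ht hRnear y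
      have eR1 : Torus.timeDerivWithin (Icc 0 T) (fun t x j => Rc t x j + Torus.traceless (M t) x j) t y = Torus.timeDerivWithin (Icc 0 T) Rc t y := by
        refine timeDerivWithin_congr_of_ball hr ht (fun s' hs' hd => ?_) y
        funext x j; show Rc s' x j + Torus.traceless (M s') x j = Rc s' x j; rw [hMnear s' hs' hd]; simp
      have eR1v : (fun j => Rc t y j + Torus.traceless (M t) y j) = Rc t y := by
        funext j; rw [hM0f]; simp
      rw [eR0, eR1, hR0f, eR1v]
      simp only [Pi.zero_apply, norm_zero, zero_add]
      have a1 := hRct t ht y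
      have a2 := hRcb t ht y
      have a3 := hθ' t ht
      have a4 := hθ'' t ht
      have p1 := mul_le_mul a3 a2 (norm_nonneg _) hΘ₁0
      have p2 : 2 * |derivWithin θ (Icc 0 T) t| * D₀ ^ 2 ≤ 2 * Θ₁ * D₀ ^ 2 :=
        mul_le_mul_of_nonneg_right (mul_le_mul_of_nonneg_left a3 (by norm_num)) (sq_nonneg _)
      have p3 : K * (|derivWithin (derivWithin θ (Icc 0 T)) (Icc 0 T) t| * D₀ + |derivWithin θ (Icc 0 T) t| * D₁') ≤ K * (Θ₂ * D₀ + Θ₁ * D₁') :=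
        mul_le_mul_of_nonneg_left (add_le_add (mul_le_mul_of_nonneg_right a4 hD00) (mul_le_mul_of_nonneg_right a3 hD₁'0)) hK0
      simp only [hSb₂]
      linarith
  -- ### Assembly
  refine ⟨vb, pb, Rcb, N, s, θ, Gm, D₀, η, Λ₁, Λ₂, Θ₁, Θ₂, S', ρc, Vb, Sb₁, Sb₂, rfl, rfl, rfl, rfl, rfl, rfl, rfl, rfl, rfl, rfl, rfl,
    hNSR, hvbmean, hRcbS, hRcbsym, hRcbtr, hNS, hNsym, hss, hs01, hs', hs_flat, hs_zero, hθs, hθ01, hθ', hθ'', hθne1, hθne0, hθflat,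
    hvb0, hvb1, hvbt, hRcb0, hN0, hN1, hNt, hN2, hNt1, hNL1, hGms, hGGm', hGbGm, hvbv, hs_sq, hsθ, huntouched, hquiet⟩

end EnergyPump

end Literature.Analysis.FluidPDE
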